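import Literature.NumberTheory.Automorphic.BCDTTheoremB
import HarnessLib

/-!
# An element of order `8` in the image of `ρ̄ : Γ_ℚ → GL₂(𝔽₃)` (`det ρ̄ = χ̄₃`) makes
# `ρ̄|_{ℚ(√-3)}` absolutely irreducible

The group-theoretic criterion used in the proof of Conrad–Diamond–Taylor 1999, Thm. 7.1.2
(p. 556; Wiles 1995, Ch. 5), case "`ρ̄_{E,3}|_{ℚ(√-3)}` absolutely irreducible": for a continuous
`ρ̄ : Γ_ℚ → GL₂(𝔽₃)` with `det ρ̄ = χ̄₃`, an element of order `8` in the image (a generator of a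
non-split Cartan `𝔽₉ˣ`; the image is then the normaliser of that Cartan or all of `GL₂(𝔽₃)`,
Serre 1972 §2.2) forces `ρ̄|_{Γ_L}` to be absolutely irreducible for every splitting field `L` of
`X² + 3`.  Architecture of the tree's `BCDT.isAbsIrreducibleOverSqrt_five_of_orderOf_eq_three`
(`CDTModularityProofs`):

* `modPCyclotomicCharacter_three_eq_one_of_mem_range` (private) — `Γ_{ℚ(√-3)} ⊆ ker χ̄₃`;
* `det_eq_neg_one_of_pow_eight_eq_one`, `anticommute_of_pow_eight_eq_one` (private) — two finite
  checks in `M₂(𝔽₃)`;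
* `false_of_mulVec_eq_smul_of_anticommute` (private) — anticommuting operators (`x² = -1`, `y`
  invertible) have no common eigenvector in characteristic `3`;
* `isAbsIrreducibleOverSqrt_negThree_of_orderOf_eq_eight` — the criterion, and its arrow form
  `orderEightCriterion`, which is VERBATIM the hypothesis `h8c` of
  `CDTThreeFiveSwitch.Road.CDT_three_five_switch_of_orderEightCriterion` (Wiles' `3`–`5` switch
  `BCDT.CDT_three_five_switch` proved modulo this criterion), so that the named fact is discharged
  inside `Literature` (`CDTThreeFiveSwitchHolds`).

Literature-side port (the import fence forbids `Summits` imports here) of the kernel-checked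
problem-side file `Summits/ABC/ABC/Theorems/DefiniteXiFreyModularityStubAbsIrrNegThreeGroup.lean`
(p113355; route DefiniteXi, crux FreyModularity, stub R3), proofs unchanged.  Nothing is defined; no
named fact is used.

## References

* [ConradDiamondTaylor1999] B. Conrad, F. Diamond, R. Taylor, J. Amer. Math. Soc. 12 (1999),
  proof of Thm. 7.1.2 (p. 556), case "`ρ̄_{E,3}|_{ℚ(√-3)}` absolutely irreducible".
* [Serre1972] J.-P. Serre, Invent. Math. 15 (1972) 259–331, §2.2 (non-split Cartan subgroups
  and their normalisers), §1.11 Prop. 12.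
-/


noncomputable section

open scoped MatrixGroups Polynomial

open Polynomial Matrix Field
open Literature.NumberTheory.EllipticCurves
open Literature.NumberTheory.Automorphic
open Literature.NumberTheory.Automorphic.BCDT
open Literature.NumberTheory.GaloisRepresentations

namespace Literature.NumberTheory.GaloisRepresentations.ModThreeOrderEight

/-! ## `Γ_{ℚ(√-3)}` acts trivially on `μ₃` -/

/-- **`χ̄₃(σ) = 1` for `σ ∈ Γ_{ℚ(√-3)}`.**  For a splitting field `L` of `X² + 3` over `ℚ` and
`σ` in the image of `Γ_L → Γ_ℚ`, the mod-`3` cyclotomic character of `σ` is trivial: with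
`ζ ∈ ℚ̄` a primitive cube root of unity, `s = ζ - ζ²` has `s² = -3`, so `s` is (the image of) an
element of `L` and `σ s = s`; but `σ ζ = ζ^a` with `a = χ̄₃(σ)`, and for `a = 2` one gets
`σ s = ζ² - ζ = -s ≠ s`.  (`ℚ(√-3) = ℚ(ζ₃)` is the fixed field of `ker χ̄₃`.) [folklore] -/
private theorem modPCyclotomicCharacter_three_eq_one_of_mem_range
    (L : Type*) [Field L] [Algebra ℚ L] [IsSplittingField ℚ L (X ^ 2 - C (-3 : ℚ))]
    {σ : absoluteGaloisGroup ℚ} (hσ : σ ∈ Set.range (absGaloisRestrict ℚ L)) :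
    modPCyclotomicCharacterZMod ℚ 3 σ = 1 := by
  -- adapted from `sq_modPCyclotomicCharacter_eq_one_of_mem_range` (`…StubAbsIrrSqrtFiveGalois`)
  haveI : FiniteDimensional ℚ L := IsSplittingField.finiteDimensional L (X ^ 2 - C (-3 : ℚ))
  -- a primitive cube root of unity `ζ ∈ ℚ̄` and `s = ζ - ζ²`, `s² = -3`
  obtain ⟨ζ, hζ⟩ := HasEnoughRootsOfUnity.exists_primitiveRoot (AlgebraicClosure ℚ) 3
  have h3 : ζ ^ 3 = 1 := hζ.pow_eq_one
  have hsum : 1 + ζ + ζ ^ 2 = 0 := by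
    have := hζ.geom_sum_eq_zero (by norm_num : 1 < 3)
    simpa [Finset.sum_range_succ] using this
  set s : AlgebraicClosure ℚ := ζ - ζ ^ 2 with hs
  have hs2 : s ^ 2 = -3 := by
    rw [hs]; linear_combination (ζ - 2) * h3 + hsum
  have hs0 : s ≠ 0 := by
    intro h0; rw [h0] at hs2; norm_num at hs2
  -- `σ` fixes `s`: `s` is the image of a square root of `-3` in `L`
  have hfix : σ • s = s := by
    obtain ⟨α, hα⟩ : ∃ α : L, α ^ 2 = -3 := by
      set p : ℚ[X] := X ^ 2 - C (-3 : ℚ) with hp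
      have hp0 : p ≠ 0 := (irreducible_X_pow_two_sub_C not_isSquare_neg_three).ne_zero
      have hdeg : p.natDegree = 2 := by rw [hp]; exact natDegree_X_pow_sub_C
      have hd : (p.map (algebraMap ℚ L)).degree ≠ 0 := by
        rw [degree_map, degree_eq_natDegree hp0, hdeg]; decide
      obtain ⟨α, hα⟩ := (IsSplittingField.splits L p).exists_eval_eq_zero hd
      refine ⟨α, ?_⟩
      have h1 : aeval α p = 0 := by rwa [aeval_def, eval₂_eq_eval_map]
      rw [hp, map_sub, map_pow, aeval_X, aeval_C, sub_eq_zero] at h1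
      simpa using h1
    set e := absClosureEquiv ℚ L with he
    have key := (mem_range_absGaloisRestrict_iff σ).mp hσ
    have hes : (e s) ^ 2 = (algebraMap L (AlgebraicClosure L) α) ^ 2 := by
      rw [← map_pow, hs2, ← map_pow, hα, map_neg, map_neg, map_ofNat, map_ofNat]
    obtain ⟨x, hx⟩ : ∃ x : L, algebraMap L (AlgebraicClosure L) x = e s := by
      rcases sq_eq_sq_iff_eq_or_eq_neg.mp hes with h | h
      · exact ⟨α, h.symm⟩
      · exact ⟨-α, by rw [map_neg, h]⟩
    have h1 := key x
    rw [hx, absGaloisTransport_apply, ← he, AlgEquiv.symm_apply_apply] at h1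
    exact e.injective h1
  -- `σ ζ = ζ ^ a`, `a = χ̄₃(σ)`
  set u := modPCyclotomicCharacterZMod ℚ 3 σ with hu
  have hζσ : σ • ζ = ζ ^ (u : ZMod 3).val := modPCyclotomicCharacterZMod_spec ℚ 3 σ ζ h3
  have hsσ : σ • s = ζ ^ (u : ZMod 3).val - (ζ ^ (u : ZMod 3).val) ^ 2 := by
    rw [hs, smul_sub, smul_pow', hζσ]
  by_contra hne
  have hval : (u : ZMod 3).val = 2 := by
    have key : ∀ w : (ZMod 3)ˣ, w ≠ 1 → (w : ZMod 3).val = 2 := by decide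
    exact key u hne
  have hneg : σ • s = -s := by
    rw [hsσ, hval, hs]
    linear_combination (-ζ) * h3
  rw [hfix] at hneg
  have h2 : (2 : AlgebraicClosure ℚ) * s = 0 := by linear_combination hneg
  rcases mul_eq_zero.mp h2 with h | h
  · norm_num at h
  · exact hs0 h

/-! ## Elements of order `8` in `GL₂(𝔽₃)`: two finite checks -/

/-- **An element of order `8` of `GL₂(𝔽₃)` has determinant `-1` and fourth power `-1`.**  A
matrix `g ∈ M₂(𝔽₃)` with `g⁸ = 1 ≠ g⁴` generates a non-split Cartan subgroup `𝔽₉ˣ`: its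
eigenvalues are a primitive eighth root of unity `ζ ∈ 𝔽₉` and its conjugate `ζ³`, so
`det g = ζ⁴ = -1` and `g⁴ = ζ⁴ = -1`.  Proved as a finite check over the `3⁴` matrices
`(a b; c d) ∈ M₂(𝔽₃)`. [folklore] -/
private theorem det_eq_neg_one_of_pow_eight_eq_one (g : Matrix (Fin 2) (Fin 2) (ZMod 3))
    (h8 : g ^ 8 = 1) (h4 : g ^ 4 ≠ 1) : g.det = -1 ∧ g ^ 4 = -1 := by
  obtain ⟨a, b, c, d, rfl⟩ : ∃ a b c d : ZMod 3, g = !![a, b; c, d] :=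
    ⟨_, _, _, _, Matrix.eta_fin_two g⟩
  rw [Matrix.det_fin_two_of]
  revert a b c d
  decide +kernel

/-- **The two anticommuting elements of order `4`.**  Let `g ∈ GL₂(𝔽₃)` have order `8`
(`g⁸ = 1 ≠ g⁴`) and let `k` be an involution of determinant `-1` (the shape of complex
conjugation).  Then `x = g²` (of order `4`, `x² = -1`) anticommutes with `k g` or with
`k x k`: the subgroup `⟨g, k⟩` is the normaliser of the non-split Cartan `⟨g⟩` (semidihedral of
order `16`, `k g k = g³`, so `k x k = -x` and `x (k g) = -(k g) x`) or all of `GL₂(𝔽₃)` (then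
`k x k ∉ ⟨x⟩` is another element of order `4` of the quaternion group `SL₂(𝔽₃)₂`, and two such
anticommute); `k ∈ ⟨g⟩` is impossible as the involution `-1 = g⁴` of `⟨g⟩` has determinant
`1`.  Proved as a finite check over the pairs `g = (a b; c d)`, `k = (p q; r s)` of `M₂(𝔽₃)`
(the hypotheses on `g` are tested before `k` is enumerated). [folklore] -/
private theorem anticommute_of_pow_eight_eq_one (g k : Matrix (Fin 2) (Fin 2) (ZMod 3))
    (h8 : g ^ 8 = 1) (h4 : g ^ 4 ≠ 1) (hk : k ^ 2 = 1) (hdk : k.det = -1) :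
    g ^ 2 * (k * g) = -(k * g * g ^ 2) ∨
      g ^ 2 * (k * g ^ 2 * k) = -(k * g ^ 2 * k * g ^ 2) := by
  obtain ⟨a, b, c, d, rfl⟩ : ∃ a b c d : ZMod 3, g = !![a, b; c, d] :=
    ⟨_, _, _, _, Matrix.eta_fin_two g⟩
  obtain ⟨p, q, r, s, rfl⟩ : ∃ p q r s : ZMod 3, k = !![p, q; r, s] :=
    ⟨_, _, _, _, Matrix.eta_fin_two k⟩
  rw [Matrix.det_fin_two_of] at hdk
  revert p q r s
  revert a b c d
  decide +kernel

/-- **Anticommuting operators have no common eigenvector** (over a field `B ⊇ 𝔽₃`, so of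
characteristic `≠ 2`): if `x² = -1`, `x y = -y x` and `y` is invertible, a common eigenvector
`v` (`x v = μ v`, `y v = ν v`) would give `μ² = -1`, `ν ≠ 0` and `2 μ ν v = (x y + y x) v = 0`.
[folklore] -/
private theorem false_of_mulVec_eq_smul_of_anticommute {B : Type*} [Field B] (f : ZMod 3 →+* B)
    {x y : Matrix (Fin 2) (Fin 2) (ZMod 3)} (hx : x * x = -1) (hxy : x * y = -(y * x))
    (hy : y.det ≠ 0) {v : Fin 2 → B} (hv : v ≠ 0) {μ ν : B}
    (hμ : x.map f *ᵥ v = μ • v) (hν : y.map f *ᵥ v = ν • v) : False := by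
  -- `μ² = -1`, so `μ ≠ 0`
  have hμ2 : μ * μ = -1 := by
    have h1 : (x.map f) *ᵥ ((x.map f) *ᵥ v) = (μ * μ) • v := by
      rw [hμ, mulVec_smul, hμ, smul_smul]
    rw [mulVec_mulVec, ← Matrix.map_mul, hx, Matrix.map_neg f (map_neg f),
      Matrix.map_one f (map_zero f) (map_one f), neg_mulVec, one_mulVec] at h1
    have h2 : (μ * μ + 1) • v = 0 := by rw [add_smul, one_smul, ← h1, neg_add_cancel]
    rcases smul_eq_zero.mp h2 with h | h
    · exact eq_neg_of_add_eq_zero_left h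
    · exact absurd h hv
  have hμ0 : μ ≠ 0 := by
    rintro rfl
    rw [mul_zero] at hμ2
    exact one_ne_zero (neg_eq_zero.mp hμ2.symm)
  -- `ν ≠ 0` as `y` is invertible
  have hν0 : ν ≠ 0 := by
    rintro rfl
    rw [zero_smul] at hν
    have h1 : (y.map f).det = 0 := Matrix.exists_mulVec_eq_zero_iff.mp ⟨v, hv, hν⟩
    have h2 : f y.det = 0 := by rw [RingHom.map_det, RingHom.mapMatrix_apply, h1]
    exact hy ((map_eq_zero f).mp h2)
  -- `(x y) v = ν μ v = -(μ ν v)`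
  have h1 : (x * y).map f *ᵥ v = (μ * ν) • v := by
    rw [Matrix.map_mul, ← mulVec_mulVec, hν, mulVec_smul, hμ, smul_smul, mul_comm]
  have h2 : (x * y).map f *ᵥ v = -((μ * ν) • v) := by
    rw [hxy, Matrix.map_neg f (map_neg f), neg_mulVec, Matrix.map_mul, ← mulVec_mulVec, hμ,
      mulVec_smul, hν, smul_smul]
  have h3 : (2 * (μ * ν)) • v = 0 := by
    rw [two_mul, add_smul]
    nth_rw 1 [← h1]
    rw [h2, neg_add_cancel]
  have h2B : (2 : B) ≠ 0 := by
    have : (2 : B) = f 2 := by rw [map_ofNat]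
    rw [this]
    exact (_root_.map_ne_zero f).mpr (by decide)
  rcases smul_eq_zero.mp h3 with h | h
  · exact mul_ne_zero h2B (mul_ne_zero hμ0 hν0) h
  · exact hv h

/-! ## An element of order `8` in the image forces absolute irreducibility over `ℚ(√-3)` -/

/-- **R3, group-theoretic half: an element of order `8` in the image of `ρ̄ : Γ_ℚ → GL₂(𝔽₃)`
(`det ρ̄ = χ̄₃`) makes `ρ̄|_{Γ_{ℚ(√-3)}}` absolutely irreducible.**  Let `L` be a splitting field
of `X² + 3`, `B ⊇ 𝔽₃` a field and `v ∈ B²` a common eigenvector of `ρ̄(Γ_L)`.  Let `G = ρ̄(σ₀)`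
have order `8` (`det G = -1`, `G⁴ = -1`, `det_eq_neg_one_of_pow_eight_eq_one`) and let
`K = ρ̄(c)` be the image of a complex conjugation (`K² = 1`, `det K = χ̄₃(c) = -1`).  Since
`Γ_L ⊆ ker χ̄₃` (`modPCyclotomicCharacter_three_eq_one_of_mem_range`) neither `σ₀` nor `c` lies
in `Γ_L`, so (index `2`) `σ₀²`, `c σ₀`, `σ₀ c`, `c σ₀² c ∈ Γ_L`; hence `v` is an eigenvector of
`x = G²` (`x² = -1`) and of `K G` and `K G² K`, one of which anticommutes with `x`
(`anticommute_of_pow_eight_eq_one`) — impossible in characteristic `3`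
(`false_of_mulVec_eq_smul_of_anticommute`).  (Conrad–Diamond–Taylor 1999, p. 556: the case
"`ρ̄_{E,3}|_{ℚ(√-3)}` absolutely irreducible" of the proof of Thm. 7.1.2; here for the image
the normaliser of a non-split Cartan subgroup or all of `GL₂(𝔽₃)`.)  Genuine restatement, with
the same proof, of the problem-side `Summit.ABC.ABC.Theorems.isAbsIrreducibleOverSqrt_negThree_of_orderOf_eq_eight`
(`Summits/ABC/ABC/Theorems/DefiniteXiFreyModularityStubAbsIrrNegThreeGroup.lean`, p113355), which
`Literature` cannot import. [cite: ConradDiamondTaylor1999, Thm. 7.1.2 (proof, p. 556)] -/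
theorem isAbsIrreducibleOverSqrt_negThree_of_orderOf_eq_eight (ρ : ModPGaloisRep ℚ (ZMod 3) 2)
    (hdet : ∀ σ : absoluteGaloisGroup ℚ,
      Matrix.GeneralLinearGroup.det (ρ σ) = modPCyclotomicCharacterZMod ℚ 3 σ)
    {σ₀ : absoluteGaloisGroup ℚ} (h8 : orderOf (ρ σ₀) = 8) :
    ρ.IsAbsIrreducibleOverSqrt (-3) := by
  -- frame adapted from `BCDT.isAbsIrreducibleOverSqrt_five_of_orderOf_eq_three`
  intro L _ _ _ B _ f
  classical
  haveI : FiniteDimensional ℚ L := IsSplittingField.finiteDimensional L (X ^ 2 - C (-3 : ℚ))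
  have h2 : Module.finrank ℚ L = 2 :=
    finrank_eq_two_of_isSplittingField_X_pow_two_sub_C not_isSquare_neg_three L
  set r := absGaloisRestrict ℚ L with hr
  -- the matrices `A g = ρ̄(g) ∈ M₂(𝔽₃)`
  set A : absoluteGaloisGroup ℚ → Matrix (Fin 2) (Fin 2) (ZMod 3) :=
    fun g ↦ ((ρ g : GL (Fin 2) (ZMod 3)) : Matrix (Fin 2) (Fin 2) (ZMod 3)) with hA
  have hAmul : ∀ g h, A (g * h) = A g * A h := fun g h ↦ by
    simp only [hA, map_mul, Units.val_mul]
  have hApow : ∀ g (n : ℕ), A (g ^ n) = A g ^ n := fun g n ↦ by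
    simp only [hA, map_pow, Units.val_pow_eq_pow_val]
  have hAdet : ∀ g, (A g).det ≠ 0 := fun g ↦ by
    rw [hA, ← Matrix.GeneralLinearGroup.val_det_apply]
    exact Units.ne_zero _
  set ρ' := (FramedGaloisRep.restrictField L ρ).baseChangeRepresentation f with hρ'def
  have hρ' : ∀ (g : absoluteGaloisGroup L) (v : Fin 2 → B), ρ' g v = (A (r g)).map f *ᵥ v := by
    intro g v
    rw [hρ'def, FramedRep.baseChangeRepresentation_apply_apply, FramedGaloisRep.restrictField_apply]
    rfl
  -- non-triviality of the lattice of subrepresentations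
  haveI : Nontrivial (Subrepresentation ρ') := by
    refine ⟨⟨⊥, ⊤, fun h ↦ ?_⟩⟩
    have h' := congrArg Subrepresentation.toSubmodule h
    exact bot_ne_top (α := Submodule B (Fin 2 → B)) h'
  refine ⟨fun S ↦ ?_⟩
  rcases eq_or_ne S ⊥ with h | hSbot
  · exact Or.inl h
  rcases eq_or_ne S ⊤ with h | hStop
  · exact Or.inr h
  exfalso
  -- `U = S` is a line `B ∙ v`
  set U : Submodule B (Fin 2 → B) := S.toSubmodule with hU
  have hUbot : U ≠ ⊥ := fun h ↦ hSbot (Subrepresentation.toSubmodule_injective h)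
  have hUtop : U ≠ ⊤ := fun h ↦ hStop (Subrepresentation.toSubmodule_injective h)
  have hfin2 : Module.finrank B (Fin 2 → B) = 2 := by simp
  have hU1 : Module.finrank B U = 1 := by
    have hlt : Module.finrank B U < Module.finrank B (Fin 2 → B) :=
      Submodule.finrank_lt hUtop
    have hpos : Module.finrank B U ≠ 0 := fun h ↦ hUbot (Submodule.finrank_eq_zero.mp h)
    omega
  obtain ⟨v, hvU, hv⟩ := Submodule.exists_mem_ne_zero_of_ne_bot hUbot
  have hUspan : U = B ∙ v := by
    refine (Submodule.eq_of_le_of_finrank_eq ((Submodule.span_singleton_le_iff_mem v U).mpr hvU)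
      ?_).symm
    rw [finrank_span_singleton hv, hU1]
  -- `v` is a common eigenvector of `ρ̄(τ)` for every `τ` in the image of `Γ_L`
  have heig : ∀ τ : absoluteGaloisGroup ℚ, τ ∈ Set.range r →
      ∃ μ : B, (A τ).map f *ᵥ v = μ • v := by
    rintro τ ⟨g, rfl⟩
    have hmem : ρ' g v ∈ U := S.apply_mem_toSubmodule g hvU
    rw [hρ', hUspan, Submodule.mem_span_singleton] at hmem
    obtain ⟨μ, hμ⟩ := hmem
    exact ⟨μ, hμ.symm⟩
  -- the element of order `8`: `G = ρ̄(σ₀)`, `G⁸ = 1 ≠ G⁴`, so `det G = -1` and `G⁴ = -1`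
  set G := A σ₀ with hG
  have hG8 : G ^ 8 = 1 := by
    change ((ρ σ₀ : GL (Fin 2) (ZMod 3)) : Matrix (Fin 2) (Fin 2) (ZMod 3)) ^ 8 = 1
    rw [← Units.val_pow_eq_pow_val, ← h8, pow_orderOf_eq_one, Units.val_one]
  have hG4 : G ^ 4 ≠ 1 := by
    intro h1
    have hne : (ρ σ₀) ^ 4 ≠ 1 := pow_ne_one_of_lt_orderOf four_ne_zero (by rw [h8]; norm_num)
    apply hne
    rw [← Units.val_eq_one, Units.val_pow_eq_pow_val]
    exact h1
  obtain ⟨hdetG, hG4'⟩ := det_eq_neg_one_of_pow_eight_eq_one G hG8 hG4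
  -- complex conjugation `c₀`, `K = ρ̄(c₀)`: `K² = 1`, `det K = -1`
  obtain ⟨c₀, hc₀⟩ := exists_isComplexConjugation (Rat.castHom ℝ)
  set K := A c₀ with hK
  have hK2 : K ^ 2 = 1 := by
    rw [hK, ← hApow, hc₀.sq_eq_one]
    simp only [hA, map_one, Units.val_one]
  have hdetK : K.det = -1 := by
    have h1 := congrArg (fun u : (ZMod 3)ˣ ↦ (u : ZMod 3)) (hdet c₀)
    simp only [Matrix.GeneralLinearGroup.val_det_apply] at h1
    rw [hK, hA, h1, modPCyclotomicCharacterZMod_eq_modNCyclotomicCharacter]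
    exact modNCyclotomicCharacter_of_isComplexConjugation (N := 3) hc₀
  -- `χ̄₃ = det ρ̄` is `-1` on `σ₀` and on `c₀`, so neither lies in `Γ_L ⊆ ker χ̄₃`
  have hχ : ∀ τ : absoluteGaloisGroup ℚ, (A τ).det = -1 → τ ∉ Set.range r := by
    intro τ hτ hmem
    have h1 := congrArg (fun u : (ZMod 3)ˣ ↦ (u : ZMod 3)) (hdet τ)
    simp only [Matrix.GeneralLinearGroup.val_det_apply] at h1
    rw [modPCyclotomicCharacter_three_eq_one_of_mem_range L hmem, Units.val_one] at h1
    simp only [hA] at hτ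
    rw [h1] at hτ
    exact absurd hτ (by decide)
  have hσ₀ : σ₀ ∉ Set.range r := hχ σ₀ hdetG
  have hc₀' : c₀ ∉ Set.range r := hχ c₀ hdetK
  have hσ₀inv : σ₀⁻¹ ∉ Set.range r := by
    rintro ⟨x, hx⟩
    exact hσ₀ ⟨x⁻¹, by rw [map_inv, hx, inv_inv]⟩
  have hc₀inv : c₀⁻¹ = c₀ := by
    rw [inv_eq_iff_mul_eq_one, ← pow_two, hc₀.sq_eq_one]
  -- hence (index `2`) `σ₀²`, `c₀ σ₀`, `σ₀ c₀`, `c₀ σ₀² c₀ ∈ Γ_L`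
  have hmul : ∀ τ₁ τ₂ : absoluteGaloisGroup ℚ, τ₁ ∈ Set.range r → τ₂ ∈ Set.range r →
      τ₁ * τ₂ ∈ Set.range r := by
    rintro τ₁ τ₂ ⟨x, rfl⟩ ⟨y, rfl⟩
    exact ⟨x * y, map_mul r x y⟩
  have hX : σ₀ ^ 2 ∈ Set.range r :=
    sq_mem_range_absGaloisRestrict_of_isSplittingField not_isSquare_neg_three L σ₀
  have hY₁ : c₀ * σ₀ ∈ Set.range r := by
    have := inv_mul_mem_range_absGaloisRestrict h2 hc₀' hσ₀
    rwa [hc₀inv] at this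
  have hY₂ : σ₀ * c₀ ∈ Set.range r := by
    have := inv_mul_mem_range_absGaloisRestrict h2 hσ₀inv hc₀'
    rwa [inv_inv] at this
  have hY₃ : c₀ * σ₀ ^ 2 * c₀ ∈ Set.range r := by
    have := hmul _ _ hY₁ hY₂
    rwa [← mul_assoc, mul_assoc c₀, ← pow_two] at this
  -- `v` is an eigenvector of `x = G²` (`x² = -1`) and of an anticommuting invertible `y`
  obtain ⟨μ, hμ⟩ := heig (σ₀ ^ 2) hX
  rw [hApow] at hμ
  have hx : G ^ 2 * G ^ 2 = -1 := by rw [← pow_add]; exact hG4'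
  rcases anticommute_of_pow_eight_eq_one G K hG8 hG4 hK2 hdetK with hanti | hanti
  · obtain ⟨ν, hν⟩ := heig (c₀ * σ₀) hY₁
    rw [hAmul] at hν
    have hyd : (K * G).det ≠ 0 := by
      rw [hK, hG, ← hAmul]; exact hAdet _
    exact false_of_mulVec_eq_smul_of_anticommute f hx hanti hyd hv hμ hν
  · obtain ⟨ν, hν⟩ := heig (c₀ * σ₀ ^ 2 * c₀) hY₃
    rw [hAmul, hAmul, hApow] at hν
    have hyd : (K * G ^ 2 * K).det ≠ 0 := by
      rw [hK, hG, ← hApow, ← hAmul, ← hAmul]; exact hAdet _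
    exact false_of_mulVec_eq_smul_of_anticommute f hx hanti hyd hv hμ hν

/-- **Arrow form of `isAbsIrreducibleOverSqrt_negThree_of_orderOf_eq_eight`** — for
`ρ̄ : Γ_ℚ → GL₂(𝔽₃)` continuous with `det ρ̄ = χ̄₃` whose image contains an element of order `8`,
`ρ̄|_{ℚ(√-3)}` is absolutely irreducible.  Verbatim the hypothesis `h8c` of
`CDTThreeFiveSwitch.Road.CDT_three_five_switch_of_orderEightCriterion`; genuine restatement of the
problem-side `Summit.ABC.ABC.Theorems.stub_absIrrNegThree_group` (p113355).
[cite: ConradDiamondTaylor1999, Thm. 7.1.2 (proof, p. 556)] -/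
theorem orderEightCriterion :
    ∀ (ρ : ModPGaloisRep ℚ (ZMod 3) 2), (∀ σ : absoluteGaloisGroup ℚ,
      Matrix.GeneralLinearGroup.det (ρ σ) = modPCyclotomicCharacterZMod ℚ 3 σ) →
      ∀ (σ₀ : absoluteGaloisGroup ℚ), orderOf (ρ σ₀) = 8 → ρ.IsAbsIrreducibleOverSqrt (-3) :=
  fun ρ hdet _ h8 ↦ isAbsIrreducibleOverSqrt_negThree_of_orderOf_eq_eight ρ hdet h8

end Literature.NumberTheory.GaloisRepresentations.ModThreeOrderEight

end
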